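import Summits.AtomisticToContinuum.Crystallization.Theorems.FrustratedLawDichotomyDRowsBccFibres

/-!
# DROWS-SOUND, bcc: the row floor on the whole scale window (leaf-free statement)

decomp-a2c hand-2 g46 — structural share for `AperiodicFrustratedLawGap` (stmt-27623), class-D rows.  `…DRowsBccFibres.bcc_rootEnergy_floor`
is stated per leaf `i < 128` of census's partition of the scale window; here the leaves are glued: for EVERY nearest-neighbour distance
`s ∈ [sNum 0/sDen, sNum 128/sDen]` (`= [0.89480…, 1.00904…]`, i.e. `s/s⋆ ∈ [0.94, 1.06]` with `s⋆ = 0.95192`),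
`e⋆ + 27/1000 ≤ rootEnergy V_LJ (count⌊bccTemplate s)` (`bcc_rootEnergy_floor_window`).  DEF-FREE.
-/

namespace Summit.AtomisticToContinuum.Crystallization.Theorems.FrustratedLawDichotomyDRowsBccWindow

open MeasureTheory
open Literature.MathematicalPhysics.StatisticalMechanics (lennardJones rootEnergy)
open Summit.AtomisticToContinuum.Crystallization.Theorems.ChargedEnergyGapNegative (E3 eStar)
open Summit.AtomisticToContinuum.Crystallization.Theorems.FrustratedLawDichotomyDRowsBcc (sNum sDen)
open Summit.AtomisticToContinuum.Crystallization.Theorems.FrustratedLawDichotomyDRowsBccSound (sNum_pos sDen_pos sNum_lt_succ)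
open Summit.AtomisticToContinuum.Crystallization.Theorems.FrustratedLawDichotomyDRowsBccTemplate (bccTemplate)
open Summit.AtomisticToContinuum.Crystallization.Theorems.FrustratedLawDichotomyDRowsBccFibres (bcc_rootEnergy_floor)

/-- the leaf ends are monotone: `sNum i ≤ sNum j` for `i ≤ j`. -/
theorem sNum_mono {i j : ℕ} (h : i ≤ j) : sNum i ≤ sNum j := by
  unfold sNum FrustratedLawDichotomyDRowsBcc.xnum; omega

/-- every scale of the window lies in some leaf. -/
theorem exists_leaf {s : ℝ} (h0 : (sNum 0 : ℝ) / sDen ≤ s) (h1 : s ≤ (sNum 128 : ℝ) / sDen) :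
    ∃ i, i < 128 ∧ (sNum i : ℝ) / sDen ≤ s ∧ s ≤ (sNum (i + 1) : ℝ) / sDen := by
  classical
  have hD : (0 : ℝ) < sDen := by exact_mod_cast sDen_pos
  -- the first leaf whose right end is ≥ s
  have hex : ∃ i, s ≤ (sNum (i + 1) : ℝ) / sDen := ⟨127, h1⟩
  refine ⟨Nat.find hex, ?_, ?_, Nat.find_spec hex⟩
  · by_contra hge
    push Not at hge
    have h127 : ¬ s ≤ (sNum (127 + 1) : ℝ) / sDen := Nat.find_min hex (lt_of_lt_of_le (by norm_num) hge)
    exact h127 h1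
  · rcases Nat.eq_zero_or_pos (Nat.find hex) with hz | hpos
    · rw [hz]; exact h0
    · have hlt : ¬ s ≤ (sNum (Nat.find hex - 1 + 1) : ℝ) / sDen := Nat.find_min hex (by omega)
      rw [Nat.sub_add_cancel hpos] at hlt
      exact le_of_lt (lt_of_not_ge hlt)

/-- ★★★ **DROWS-SOUND, bcc, on the whole window.**  For every `s ∈ [sNum 0/sDen, sNum 128/sDen]` (`s/s⋆ ∈ [0.94, 1.06]`):
`e⋆ + 27/1000 ≤ rootEnergy V_LJ (count⌊bccTemplate s)`. [this route] -/
theorem bcc_rootEnergy_floor_window {s : ℝ} (h0 : (sNum 0 : ℝ) / sDen ≤ s) (h1 : s ≤ (sNum 128 : ℝ) / sDen) :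
    eStar + 27 / 1000 ≤ rootEnergy lennardJones (Measure.count.restrict (bccTemplate s) : Measure E3) := by
  obtain ⟨i, hi, hs1, hs2⟩ := exists_leaf h0 h1
  exact bcc_rootEnergy_floor hi hs1 hs2

/-- the window in decimals: it contains `[0.8949, 1.009]` (so in particular every `s` with `|s/0.95192 − 1| ≤ 0.06` up to rounding). -/
theorem window_bounds : (sNum 0 : ℝ) / sDen ≤ 8949 / 10000 ∧ (1009 : ℝ) / 1000 ≤ (sNum 128 : ℝ) / sDen := by
  have e0 : (sNum 0 : ℝ) = 95192 * 12032 := by unfold sNum FrustratedLawDichotomyDRowsBcc.xnum; push_cast; ring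
  have e1 : (sNum 128 : ℝ) = 95192 * (12032 + 12 * 128) := by unfold sNum FrustratedLawDichotomyDRowsBcc.xnum; push_cast; ring
  have eD : (sDen : ℝ) = 100000 * 12800 := by unfold sDen FrustratedLawDichotomyDRowsBcc.XD; push_cast; ring
  rw [e0, e1, eD]
  constructor <;> norm_num

/-- ★ decimal corollary: every bcc template with nearest-neighbour distance `s ∈ [0.8949, 1.009]` has root energy `≥ e⋆ + 0.027`. [this route] -/
theorem bcc_rootEnergy_floor_decimal {s : ℝ} (h0 : (8949 : ℝ) / 10000 ≤ s) (h1 : s ≤ (1009 : ℝ) / 1000) :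
    eStar + 27 / 1000 ≤ rootEnergy lennardJones (Measure.count.restrict (bccTemplate s) : Measure E3) :=
  bcc_rootEnergy_floor_window (window_bounds.1.trans h0) (h1.trans window_bounds.2)

end Summit.AtomisticToContinuum.Crystallization.Theorems.FrustratedLawDichotomyDRowsBccWindow
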